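import Summits.FinalStateConjecture.FinalStateConjecture.Theorems.ExactKerrEndsSettlingAlongCensoredKerrEndsFromSummit
import Summits.FinalStateConjecture.FinalStateConjecture.Theorems.ExactKerrEndsTrivialDatumWitness
import Summits.FinalStateConjecture.FinalStateConjecture.Theorems.WeakCosmicCensorshipMGHD.Negative.TruncatedMinkowski
import Literature.Geometry.Lorentzian.ExactKerrEnd
import HarnessLib

/-!
# Crux `SettlingAlongCensoredKerrEnds` (stmt-FinalStateConjecture-18520, route `ExactKerrEnds`, rank 2):
# what is load-bearing, and the shape of every proof and of every counterexample

Write `C₂` for the crux and, for an initial data set `D`, `KE D` (Kerr-ended, the let-bound legend =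
`InitialDataSet.HasExactKerrEnd` by `InitialDataSet.hasExactKerrEnd_iff`, `Iff.rfl`), `Cen D` (every
maximal vacuum Cauchy development has complete `𝓘⁺`) and `Settled D` (every maximal vacuum Cauchy
development has complete `𝓘⁺` AND an honest sub-extremal `C²` final-state decomposition of
`O = exteriorOf`, rays confined, charts exhaustive and future-oriented).  `C₂`: along every tame curve `F`
of admissible data, immersed-injective or constant [H2], whose members off `0` are `KE ∧ Cen` [H4],
there is a tame injective immersed admissible curve `F'` through `F 0` with `Settled` members off `0`.
Companion of `…SettlingAlongCensoredKerrEndsFromSummit` (summit ⇒ `C₂`; `C₂` ⇔ summit under the other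
items) and of the `C₁` analysis `CensorshipAlongKerrEnds/Negative/RefutationShape`. Recorded, kernel-checked:

* `kerrEndedCensoredSelfWitness` — through every admissible `KE ∧ Cen` datum passes a tame injective
  immersed admissible curve ALL of whose members are `KE ∧ Cen` (its breathing curve);
* `settlingAlongCensoredKerrEnds_iff_immInjCase` — the constant disjunct of [H2] is idle: `C₂` is
  equivalent to its immersed-injective case;
* `settlingAlongCensoredKerrEnds_of_settled_bases` — `C₂` follows from POINTWISE settling of the base
  data `F 0` of hypothesis curves only (self-witness), i.e. of the admissible data in the tame adherence
  of `KE ∧ Cen`;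
* `exists_isMaximal_not_settled_of_not_settlingAlongCensoredKerrEnds` — REFUTATION CERTIFICATE: every
  proof of `¬ C₂` exhibits an admissible datum which is the base of a hypothesis curve (so `KE ∧ Cen`
  itself, or a weighted-`C²₋₁ × C¹₋₂` limit of `KE ∧ Cen` admissible data along a tame immersed curve)
  together with a CERTIFIED MAXIMAL vacuum Cauchy development of it violating the settling clause
  (incomplete `𝓘⁺`, or no honest sub-extremal decomposition).  No `IsMaximal` certificate of a non-flat
  datum exists in the tree (Choquet-Bruhat–Geroch is an undischarged named fact) and every MGHD of the
  flat datum settles (`ChannelsResolveTameDevelopmentsR.TrivialDatum.settlesT2_of_isMaximal`), so no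
  refutation of `C₂` is typable today, whatever the physics;
* `settlingAlongCensoredKerrEnds_false_without_isMaximal_of` — `IsMaximal` inside `Settled` is
  load-bearing, modulo the same true, unconstructed fact `H` as the sibling load-bearing lemmas (every
  admissible datum on `ℝ³` has SOME vacuum Cauchy development with incomplete `𝓘⁺`; for the trivial
  datum this is the time-truncated Minkowski space `WeakCosmicCensorshipMGHD.Negative.truncated`), and
  `not_settledWithoutIsMaximal_trivialData` — unconditionally, the maximality-free settling clause
  already fails AT the trivial datum (whose maximal developments all settle).

No `sorry`, no definitions, no named facts. References: Christodoulou, CQG 16 (1999) A23, p. A24;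
Choquet-Bruhat–Geroch, CMP 14 (1969), p. 330 and Thm. 3; Dafermos–Luk, arXiv:1710.01722, Conjecture 1.
-/

set_option linter.dupNamespace false

noncomputable section

open Set Function Filter TopologicalSpace
open scoped Manifold ContDiff Topology

namespace Summit.FinalStateConjecture.FinalStateConjecture.Theorems.ExactKerrEnds

open Literature.Geometry.Lorentzian
open Summit.FinalStateConjecture (HasCompleteNullInfinity exteriorOf RaysStayInClosure HasExhaustiveCharts
  IsFutureOriented)
open Summit.FinalStateConjecture.FinalStateConjecture.Theses.ExactKerrEnds (SettlingAlongCensoredKerrEnds)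

section Helpers

variable {X : Type} [TopologicalSpace X] [ChartedSpace E3 X] [IsManifold (𝓡 3) ∞ X] [T2Space X]
  [SecondCountableTopology X] [ConnectedSpace X]

omit [T2Space X] [SecondCountableTopology X] [ConnectedSpace X] in
/-- A constant curve whose members off `0` have a property has it at the base (`ℝ¹` has a non-zero
vector). [folklore] -/
private theorem base_of_const {F : EuclideanSpace ℝ (Fin 1) → InitialDataSet (𝓡 3) X}
    {Q : InitialDataSet (𝓡 3) X → Prop} (hconst : ∀ c, F c = F 0) (hQ : ∀ c ≠ 0, Q (F c)) :
    Q (F 0) := by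
  have hc : (EuclideanSpace.single (0 : Fin 1) (1 : ℝ) : EuclideanSpace ℝ (Fin 1)) ≠ 0 := by
    rw [← norm_ne_zero_iff, PiLp.norm_single, norm_one]
    exact one_ne_zero
  rw [← hconst (EuclideanSpace.single (0 : Fin 1) (1 : ℝ))]
  exact hQ _ hc

/-- **Kerr-ended censored self-witness.** Through every admissible datum `d` which is Kerr-ended and
censored passes a tame (on a collared restriction of its sole end), injective, immersed curve of
admissible data, `F' 0 = d`, ALL of whose members are Kerr-ended and censored: the breathing curve of
`d` (members `(breathe (σ t))^* d`; Kerr-endedness by `HasExactKerrEnd.breatheFamily`, censoredness by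
`censored_breatheFamily`). [cite: Christodoulou1999, p. A24] -/
theorem kerrEndedCensoredSelfWitness {d : InitialDataSet (𝓡 3) X} (hd : d ∈ admissibleVacuumData X)
    (hKE : d.HasExactKerrEnd)
    (hCen : ∀ 𝒟 : VacuumCauchyDevelopment d, 𝒟.IsMaximal → HasCompleteNullInfinity 𝒟.toCauchyDevelopment) :
    ∃ (e' : AFEnd X) (F' : EuclideanSpace ℝ (Fin 1) → InitialDataSet (𝓡 3) X),
      InitialDataSet.IsTameDataFamily e' 1 F' ∧ F' 0 = d ∧ Injective F' ∧
        InitialDataSet.IsImmersedAtZero 1 F' ∧ (∀ c, F' c ∈ admissibleVacuumData X) ∧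
          ∀ c, (F' c).HasExactKerrEnd ∧
            ∀ 𝒟 : VacuumCauchyDevelopment (F' c), 𝒟.IsMaximal →
              HasCompleteNullInfinity 𝒟.toCauchyDevelopment := by
  obtain ⟨-, e₀, M, hsole, hdecay⟩ := id hd
  set z₀ : E3 := (e₀.R + 3) • EuclideanSpace.single (0 : Fin 3) (1 : ℝ) with hz₀
  have hz₀n : ‖z₀‖ = e₀.R + 3 := by
    rw [hz₀, norm_smul, PiLp.norm_single, norm_one, mul_one,
      Real.norm_of_nonneg (by linarith [e₀.R_pos])]
  have B : e₀.BreathingData z₀ 1 := ⟨one_pos, by rw [hz₀n]; linarith⟩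
  have hR₁ : e₀.R < e₀.R + 1 := by linarith
  exact ⟨e₀.restrict hR₁.le, fun c ↦ AFEnd.breatheFamily B d (c 0),
    AFEnd.isTameDataFamily_restrict_breatheCurve B d hsole hdecay hR₁,
    AFEnd.breatheCurve_zero B d, AFEnd.injective_breatheCurve B d,
    AFEnd.isImmersedAtZero_breatheCurve B d,
    fun c ↦ AFEnd.breatheCurve_mem_admissibleVacuumData B d hd c,
    fun c ↦ ⟨hKE.breatheFamily B (c 0), censored_breatheFamily B d (c 0) hCen⟩⟩

end Helpers

/-! ## §1 The constant disjunct of [H2] is idle -/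

/-- **`C₂` is equivalent to its immersed-injective case.** Along a CONSTANT admissible curve with
Kerr-ended censored members the base is Kerr-ended and censored, hence the base of its own Kerr-ended
censored breathing curve (`kerrEndedCensoredSelfWitness`), which is tame, injective and immersed — a
legal input of the immersed case, whose answer is an answer for the constant curve.
[cite: Christodoulou1999, p. A24] -/
theorem settlingAlongCensoredKerrEnds_iff_immInjCase :
    SettlingAlongCensoredKerrEnds ↔
      ∀ (X : Type) [TopologicalSpace X] [ChartedSpace E3 X] [IsManifold (𝓡 3) ∞ X] [T2Space X]
        [SecondCountableTopology X] [ConnectedSpace X],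
        ∀ (e : AFEnd X) (F : EuclideanSpace ℝ (Fin 1) → InitialDataSet (𝓡 3) X),
          InitialDataSet.IsTameDataFamily e 1 F → InitialDataSet.IsImmersedAtZero 1 F →
            Injective F → (∀ c, F c ∈ admissibleVacuumData X) →
              (∀ c ≠ 0, (F c).HasExactKerrEnd ∧
                ∀ 𝒟 : VacuumCauchyDevelopment (F c), 𝒟.IsMaximal →
                  HasCompleteNullInfinity 𝒟.toCauchyDevelopment) →
                ∃ (e' : AFEnd X) (F' : EuclideanSpace ℝ (Fin 1) → InitialDataSet (𝓡 3) X),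
                  InitialDataSet.IsTameDataFamily e' 1 F' ∧ F' 0 = F 0 ∧ Injective F' ∧
                    InitialDataSet.IsImmersedAtZero 1 F' ∧ (∀ c, F' c ∈ admissibleVacuumData X) ∧
                      ∀ c ≠ 0, ∀ 𝒟 : VacuumCauchyDevelopment (F' c), 𝒟.IsMaximal →
                        HasCompleteNullInfinity 𝒟.toCauchyDevelopment ∧
                          ∃ (O : Set 𝒟.carrier) (dd : FinalStateDecomposition 𝒟.toSpacetime O 2),
                            (∀ i, Kerr.IsSubextremal (dd.mass i) (dd.spin i)) ∧
                              O = exteriorOf 𝒟.toCauchyDevelopment dd.charted ∧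
                                RaysStayInClosure 𝒟.toCauchyDevelopment O ∧ HasExhaustiveCharts dd ∧
                                  IsFutureOriented dd := by
  refine ⟨fun h X _ _ _ _ _ _ e F hF himm hinj h𝓓 hQ ↦
      h X e F hF (Or.inl ⟨himm, hinj⟩) h𝓓 fun c hc ↦ ⟨(hQ c hc).1, (hQ c hc).2⟩,
    fun h ↦ ?_⟩
  intro X _ _ _ _ _ _ _ _ _ e F hF hdich h𝓓 hQ
  rcases hdich with ⟨himm, hinj⟩ | hconst
  · exact h X e F hF himm hinj h𝓓 fun c hc ↦ ⟨(hQ c hc).1, (hQ c hc).2⟩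
  · -- the base is Kerr-ended and censored; run the immersed case on its breathing curve
    have hQ0 := base_of_const (Q := fun D ↦ D.HasExactKerrEnd ∧
      ∀ 𝒟 : VacuumCauchyDevelopment D, 𝒟.IsMaximal → HasCompleteNullInfinity 𝒟.toCauchyDevelopment)
      hconst fun c hc ↦ ⟨(hQ c hc).1, (hQ c hc).2⟩
    obtain ⟨e', F', hF', h0', hinj', himm', h𝓓', hQ'⟩ :=
      kerrEndedCensoredSelfWitness (h𝓓 0) hQ0.1 hQ0.2
    obtain ⟨e'', F'', hF'', h0'', hrest⟩ := h X e' F' hF' himm' hinj' h𝓓' fun c _ ↦ hQ' c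
    exact ⟨e'', F'', hF'', h0''.trans h0', hrest⟩

/-! ## §2 Every proof is pointwise settling on the tame adherence of `KE ∧ Cen`; every counterexample
is a certified non-settling MGHD there -/

/-- **`C₂` from pointwise settling of the BASE data of its hypothesis curves.** If every admissible
datum `F 0` which is the base of a tame curve `F` of admissible data (immersed-injective or constant)
with Kerr-ended censored members off `0` is itself settled (every maximal vacuum Cauchy development has
complete `𝓘⁺` and an honest sub-extremal decomposition), then `C₂` holds: the breathing curve of
`F 0` is the answer (`settledSelfWitness`). Sharper than `settlingAlongCensoredKerrEnds_of_settledCurves`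
in that only the tame adherence of `KE ∧ Cen` is constrained. [cite: Christodoulou1999, p. A24] -/
theorem settlingAlongCensoredKerrEnds_of_settled_bases :
    (∀ (X : Type) [TopologicalSpace X] [ChartedSpace E3 X] [IsManifold (𝓡 3) ∞ X] [T2Space X]
      [SecondCountableTopology X] [ConnectedSpace X],
      ∀ (e : AFEnd X) (F : EuclideanSpace ℝ (Fin 1) → InitialDataSet (𝓡 3) X),
        InitialDataSet.IsTameDataFamily e 1 F →
          ((InitialDataSet.IsImmersedAtZero 1 F ∧ Injective F) ∨ ∀ c, F c = F 0) →
            (∀ c, F c ∈ admissibleVacuumData X) →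
              (∀ c ≠ 0, (F c).HasExactKerrEnd ∧
                ∀ 𝒟 : VacuumCauchyDevelopment (F c), 𝒟.IsMaximal →
                  HasCompleteNullInfinity 𝒟.toCauchyDevelopment) →
                ∀ 𝒟 : VacuumCauchyDevelopment (F 0), 𝒟.IsMaximal →
                  HasCompleteNullInfinity 𝒟.toCauchyDevelopment ∧
                    ∃ (O : Set 𝒟.carrier) (dd : FinalStateDecomposition 𝒟.toSpacetime O 2),
                      (∀ i, Kerr.IsSubextremal (dd.mass i) (dd.spin i)) ∧
                        O = exteriorOf 𝒟.toCauchyDevelopment dd.charted ∧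
                          RaysStayInClosure 𝒟.toCauchyDevelopment O ∧ HasExhaustiveCharts dd ∧
                            IsFutureOriented dd) →
      SettlingAlongCensoredKerrEnds := by
  intro h X _ _ _ _ _ _ _ _ _ e F hF hdich h𝓓 hQ
  obtain ⟨_, hsole, ⟨M, _, hSAF⟩, _⟩ := id hF
  exact settledSelfWitness X e (F 0) (InitialDataSet.isTameDataFamily_const hsole 1 (hSAF 0)) (h𝓓 0)
    (h X e F hF hdich h𝓓 fun c hc ↦ ⟨(hQ c hc).1, (hQ c hc).2⟩)

/-- **REFUTATION CERTIFICATE.** Any proof of `¬ C₂` produces a `3`-manifold `X`, a tame curve `F` of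
admissible data on an end of `X`, immersed-injective or constant, whose members off `0` are Kerr-ended
and censored, and a MAXIMAL vacuum Cauchy development of the base datum `F 0` (an admissible datum in
the weighted-`C²₋₁ × C¹₋₂` tame adherence of `KE ∧ Cen`) which either has incomplete future null
infinity or carries no honest sub-extremal `C²` final-state decomposition. In the current tree no
non-flat datum has a certified maximal development (Choquet-Bruhat–Geroch is an undischarged named
fact) and every maximal development of the flat datum settles, so `¬ C₂` is at present unprovable
whatever the physics; in print no censored smooth vacuum datum with a non-settling maximal development
is known. [cite: ChoquetBruhatGeroch1969CMP, Theorem p. 331] [cite: DafermosLuk2017, Conjecture 1] -/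
theorem exists_isMaximal_not_settled_of_not_settlingAlongCensoredKerrEnds :
    ¬ SettlingAlongCensoredKerrEnds →
    ∃ (X : Type) (_ : TopologicalSpace X) (_ : ChartedSpace E3 X) (_ : IsManifold (𝓡 3) ∞ X)
      (_ : T2Space X) (_ : SecondCountableTopology X) (_ : ConnectedSpace X)
      (e : AFEnd X) (F : EuclideanSpace ℝ (Fin 1) → InitialDataSet (𝓡 3) X),
      InitialDataSet.IsTameDataFamily e 1 F ∧
        ((InitialDataSet.IsImmersedAtZero 1 F ∧ Injective F) ∨ ∀ c, F c = F 0) ∧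
          (∀ c, F c ∈ admissibleVacuumData X) ∧
            (∀ c ≠ 0, (F c).HasExactKerrEnd ∧
              ∀ 𝒟 : VacuumCauchyDevelopment (F c), 𝒟.IsMaximal →
                HasCompleteNullInfinity 𝒟.toCauchyDevelopment) ∧
              ∃ 𝒟 : VacuumCauchyDevelopment (F 0), 𝒟.IsMaximal ∧
                (HasCompleteNullInfinity 𝒟.toCauchyDevelopment →
                  ¬ ∃ (O : Set 𝒟.carrier) (dd : FinalStateDecomposition 𝒟.toSpacetime O 2),
                    (∀ i, Kerr.IsSubextremal (dd.mass i) (dd.spin i)) ∧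
                      O = exteriorOf 𝒟.toCauchyDevelopment dd.charted ∧
                        RaysStayInClosure 𝒟.toCauchyDevelopment O ∧ HasExhaustiveCharts dd ∧
                          IsFutureOriented dd) := by
  intro h
  by_contra hno
  refine h (settlingAlongCensoredKerrEnds_of_settled_bases fun X _ _ _ _ _ _ e F hF hdich h𝓓 hQ 𝒟 h𝒟 ↦ ?_)
  by_contra hbad
  refine hno ⟨X, inferInstance, inferInstance, inferInstance, inferInstance, inferInstance,
    inferInstance, e, F, hF, hdich, h𝓓, hQ, 𝒟, h𝒟, fun hcni hdec ↦ hbad ⟨hcni, hdec⟩⟩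

/-! ## §3 `IsMaximal` inside `Settled` is load-bearing -/

/-- **`C₂` with `IsMaximal` DELETED from its conclusion is false, modulo the true, here unconstructed
fact `H`** that every admissible datum on `ℝ³` has SOME vacuum Cauchy development with incomplete
future null infinity (local existence followed by truncation in a Cauchy time function; the same `H`
as `CensorshipAlongKerrEnds.Negative.censorshipAlongKerrEnds_false_without_isMaximal_of` and
`WeakCosmicCensorshipTame.Negative.LoadBearing`): feed the maximality-free statement the constant curve
at the trivial datum `(ℝ³, δ, 0)` — admissible (`trivialData_mem_admissibleVacuumData`), Kerr-ended
(`hasExactKerrEnd_trivialData`, `M = 0`) and censored (`censored_trivialData`); every member of the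
answered curve is admissible on `ℝ³`, so by `H` one of its developments has incomplete `𝓘⁺`.
[cite: ChoquetBruhatGeroch1969CMP, p. 330] -/
theorem settlingAlongCensoredKerrEnds_false_without_isMaximal_of :
    (∀ D ∈ admissibleVacuumData Minkowski.slice, ∃ 𝒟 : VacuumCauchyDevelopment D,
      ¬ HasCompleteNullInfinity 𝒟.toCauchyDevelopment) →
    ¬ ∀ (X : Type) [TopologicalSpace X] [ChartedSpace E3 X] [IsManifold (𝓡 3) ∞ X] [T2Space X]
        [SecondCountableTopology X] [ConnectedSpace X],
        ∀ (e : AFEnd X) (F : EuclideanSpace ℝ (Fin 1) → InitialDataSet (𝓡 3) X),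
          InitialDataSet.IsTameDataFamily e 1 F →
            ((InitialDataSet.IsImmersedAtZero 1 F ∧ Injective F) ∨ ∀ c, F c = F 0) →
              (∀ c, F c ∈ admissibleVacuumData X) →
                (∀ c ≠ 0, (F c).HasExactKerrEnd ∧
                  ∀ 𝒟 : VacuumCauchyDevelopment (F c), 𝒟.IsMaximal →
                    HasCompleteNullInfinity 𝒟.toCauchyDevelopment) →
                  ∃ (e' : AFEnd X) (F' : EuclideanSpace ℝ (Fin 1) → InitialDataSet (𝓡 3) X),
                    InitialDataSet.IsTameDataFamily e' 1 F' ∧ F' 0 = F 0 ∧ Injective F' ∧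
                      InitialDataSet.IsImmersedAtZero 1 F' ∧ (∀ c, F' c ∈ admissibleVacuumData X) ∧
                        ∀ c ≠ 0, ∀ 𝒟 : VacuumCauchyDevelopment (F' c),
                          HasCompleteNullInfinity 𝒟.toCauchyDevelopment ∧
                            ∃ (O : Set 𝒟.carrier) (dd : FinalStateDecomposition 𝒟.toSpacetime O 2),
                              (∀ i, Kerr.IsSubextremal (dd.mass i) (dd.spin i)) ∧
                                O = exteriorOf 𝒟.toCauchyDevelopment dd.charted ∧
                                  RaysStayInClosure 𝒟.toCauchyDevelopment O ∧ HasExhaustiveCharts dd ∧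
                                    IsFutureOriented dd := by
  intro H h
  have hd : trivialData ∈ admissibleVacuumData Minkowski.slice := trivialData_mem_admissibleVacuumData
  obtain ⟨-, e, M, hsole, hdecay⟩ := id hd
  obtain ⟨e', F', -, -, -, -, h𝓓', hgood⟩ :=
    h Minkowski.slice e (fun _ ↦ trivialData) (InitialDataSet.isTameDataFamily_const hsole 1 hdecay)
      (Or.inr fun _ ↦ rfl) (fun _ ↦ hd) fun _ _ ↦ ⟨hasExactKerrEnd_trivialData, censored_trivialData⟩
  have hc : (EuclideanSpace.single (0 : Fin 1) (1 : ℝ) : EuclideanSpace ℝ (Fin 1)) ≠ 0 := by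
    rw [← norm_ne_zero_iff, PiLp.norm_single, norm_one]
    exact one_ne_zero
  obtain ⟨𝒟, h𝒟⟩ := H (F' _) (h𝓓' (EuclideanSpace.single (0 : Fin 1) (1 : ℝ)))
  exact h𝒟 (hgood _ hc 𝒟).1

/-- **The unconditional residue: the trivial datum itself is not "settled without `IsMaximal`".**
The time-truncated Minkowski space `WeakCosmicCensorshipMGHD.Negative.truncated` is a vacuum Cauchy
development of `(ℝ³, δ, 0)` with INCOMPLETE future null infinity
(`not_hasCompleteNullInfinity_truncated`), so the maximality-free settling clause fails at the trivial
datum — whereas every MAXIMAL development of it settles. (What `H` adds in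
`settlingAlongCensoredKerrEnds_false_without_isMaximal_of`: the members `F' c`, `c ≠ 0`, of an answer
curve are arbitrary admissible data near the base, out of the refuter's hands.)
[cite: Christodoulou1999, pp. A26–A27] -/
theorem not_settledWithoutIsMaximal_trivialData :
    ¬ ∀ 𝒟 : VacuumCauchyDevelopment trivialData,
        HasCompleteNullInfinity 𝒟.toCauchyDevelopment ∧
          ∃ (O : Set 𝒟.carrier) (dd : FinalStateDecomposition 𝒟.toSpacetime O 2),
            (∀ i, Kerr.IsSubextremal (dd.mass i) (dd.spin i)) ∧
              O = exteriorOf 𝒟.toCauchyDevelopment dd.charted ∧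
                RaysStayInClosure 𝒟.toCauchyDevelopment O ∧ HasExhaustiveCharts dd ∧
                  IsFutureOriented dd := fun h ↦
  WeakCosmicCensorshipMGHD.Negative.not_hasCompleteNullInfinity_truncated
    (h WeakCosmicCensorshipMGHD.Negative.truncated).1

end Summit.FinalStateConjecture.FinalStateConjecture.Theorems.ExactKerrEnds

end
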